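/-
Literature/Analysis/Quadrature/ScrambledNetVarianceL2.lean

The variance of Owen-scrambled nets for square-integrable integrands: Corollary 13.4 and
Theorem 13.5 of Dick–Pillichshammer for `f ∈ L_2` (the passage from Walsh polynomials to `L_2`
by Parseval's identity), and Theorem 13.22 without the finite-precision hypothesis.
-/
import Mathlib
import Literature.Analysis.Quadrature.WalshCompleteness

/-!
# The variance of Owen-scrambled nets for square-integrable integrands

[DickPillichshammer2010] J. Dick, F. Pillichshammer, *Digital Nets and Sequences. Discrepancy
Theory and Quasi-Monte Carlo Integration*, Cambridge University Press 2010, §13.2–§13.3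
(Corollary 13.4, Theorem 13.5) and §13.5 (Theorem 13.22); the `L_2` passage is Parseval's
identity for the Walsh system (Theorem A.11, eq. (13.6)), file `WalshCompleteness`.

`ScrambledNetVariance` proves Corollary 13.4 and Theorem 13.5 for WALSH POLYNOMIALS
`f = Σ_{k < b^L} c_k wal_k` on the digit space (its docstring: "the passage from Walsh polynomials
to `L_2` is Parseval's identity (13.6), not formalised here"), and `ScrambledNetSmoothIntegrands`
proves Theorem 13.22 for integrands depending on finitely many digits (its modelling note (2)).
This file performs the passage to `L_2`. For `f ∈ L_2` of the digit space
(`MemLp f 2 (digitSeqMeasure b)`), with `σ_ℓ²(f) = blockVariance b (walshCoeffD b f) ℓ` the nested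
ANOVA variances and `Î(f) = scrambledAverage b Π ξ f` the randomised QMC estimator over points with
digit sequences `ξ_n`, all scrambled by ONE uniform nested scramble `Π` (`scrambleMeasure b`):

* `integral_scrambledAverage` — unbiasedness `E[Î(f)] = ∫ f` for integrable `f`
  [DP2010, Prop. 13.1 and the display following it];
* `integral_norm_sq_scrambledAverage_le` — `E|Î(g)|² ≤ ∫ |g|²` for `g ∈ L_2` (each scrambled point
  is uniformly distributed, Prop. 13.1, and Jensen's inequality) [folklore];
* `gainFactor_nonneg` — the coefficients `G_ℓ = (b M_ℓ - M_{ℓ-1})/(b-1)` of Corollary 13.4 are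
  `≥ 0`;
* `hasSum_gainFactor_mul_blockVariance` — **Corollary 13.4** for `f ∈ L_2`:
  `Var[Î(f)] = E|Î(f) - ∫ f|² = N⁻² Σ_{ℓ=1}^{∞} G_ℓ σ_ℓ²(f)`, a convergent series;
* `IsDigitNet.integral_norm_sq_scrambledAverage_sub_eq_of_memLp` — **Theorem 13.5**, first part,
  for `f ∈ L_2`: for a scrambled `(0, m, 1)`-net in base `b`,
  `Var[Î(f)] = b^{-m} Σ_{ℓ > m} σ_ℓ²(f) = b^{-m} ∫ |f - E_m f|²`
  (also as a series, `IsDigitNet.hasSum_blockVariance_of_memLp`);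
* `IsDigitNet.integral_norm_sq_scrambledAverage_sub_le_of_memLp` — **Theorem 13.5**, second
  part, for `f ∈ L_2`: for a scrambled `(t, m, 1)`-net in base `b`,
  `Var[Î(f)] ≤ b^{t-m} Σ_{ℓ > m-t} σ_ℓ²(f) = b^{t-m} ∫ |f - E_{m-t} f|²`;
* `IsDigitNet.integral_norm_sq_scrambledAverage_sub_le_of_holder'` — **Theorem 13.22** for every
  measurable digit-Hölder integrand of order `0 < α ≤ 1` (no finite-precision hypothesis):
  `Var[Î(f)] ≤ b^{-(1+2α)(m-t)} C_f² (b-1)^{1+2α}/(b^{2α}-1)`.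

Method. `E_L f = S_{b^L}(·, f)` is the Walsh polynomial with coefficients `f̂(k)`, `k < b^L`
(`sum_walshCoeffD_mul_walshD`), to which the tree theorems apply; `Î` is linear and
`E|Î(f - E_L f)|² ≤ ∫ |f - E_L f|² → 0` (Theorem A.19 (3),
`tendsto_integral_norm_sq_sub_levelMean`), so `E|Î(E_L f) - ∫ f|² → E|Î(f) - ∫ f|²` by an
elementary squeeze (`tendsto_integral_norm_sq_of_sub`), while the right-hand sides converge to the
tails of `Σ_ℓ σ_ℓ²(f)` (eq. (13.6), `hasSum_blockVariance_walshCoeffD_add`).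

Modelling notes. (1) As in the files this one extends, everything is on the digit space
`ℕ → Fin b` with the product digit law `digitSeqMeasure b` (the law of the digits of a uniform
point of `[0,1)`), for an arbitrary base `b ≥ 2` (DP2010 take `b` prime in §13.3 only to use Walsh
functions over `ℤ_b`; nothing below needs it) and a finite index type `κ` of points (`N = |κ|`).
(2) "Variance" means the centred second moment `E|Î(f) - ∫ f|²`, which is the variance by
unbiasedness (`integral_scrambledAverage`). (3) Complex-valued `f` (real `f` is a special case).
-/

open MeasureTheory Complex Finset Filter Topology

open scoped ComplexConjugate ENNReal

noncomputable section

namespace Literature.Analysis.Quadrature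

variable {b : ℕ}

/-! ### An elementary squeeze: `L_2`-convergence implies convergence of second moments -/

section Squeeze

variable {α : Type*} [MeasurableSpace α] {ν : Measure α}

/-- `2xy ≤ t x² + y²/t` for `t > 0`. [folklore] -/
private theorem two_mul_mul_le_of_pos {t : ℝ} (ht : 0 < t) (x y : ℝ) :
    2 * x * y ≤ t * x ^ 2 + t⁻¹ * y ^ 2 := by
  have ht' : t ≠ 0 := ht.ne'
  have h : t * x ^ 2 + t⁻¹ * y ^ 2 - 2 * x * y = t⁻¹ * (t * x - y) ^ 2 := by
    field_simp
    ring
  have h2 : 0 ≤ t⁻¹ * (t * x - y) ^ 2 := by positivity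
  linarith

/-- `|u|² ≤ (1 + t)|v|² + (1 + 1/t)|u - v|²` for `t > 0`. [folklore] -/
private theorem norm_sq_le_of_pos {t : ℝ} (ht : 0 < t) (u v : ℂ) :
    ‖u‖ ^ 2 ≤ ‖v‖ ^ 2 + t * ‖v‖ ^ 2 + (1 + t⁻¹) * ‖u - v‖ ^ 2 := by
  have h1 : ‖u‖ ≤ ‖v‖ + ‖u - v‖ := norm_le_norm_add_norm_sub' u v
  have h2 : ‖u‖ ^ 2 ≤ (‖v‖ + ‖u - v‖) ^ 2 := pow_le_pow_left₀ (norm_nonneg u) h1 2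
  have h3 := two_mul_mul_le_of_pos ht ‖v‖ ‖u - v‖
  nlinarith [h2, h3]

/-- `|F|²` is integrable for `F ∈ L_2`. [folklore] -/
private theorem integrable_norm_sq_of_memLp₂ {F : α → ℂ} (hF : MemLp F 2 ν) :
    Integrable (fun x => ‖F x‖ ^ 2) ν :=
  (memLp_two_iff_integrable_sq_norm hF.1).1 hF

/-- **Second moments are continuous along `L_2`-convergent sequences**: if `a, u_L ∈ L_2` and
`∫ |a - u_L|² → 0`, then `∫ |u_L|² → ∫ |a|²`. (Elementary squeeze avoiding square roots: integrate
`|u|² ≤ (1+t)|a|² + (1+1/t)|u - a|²` and the same with `a, u` exchanged, then let `t → 0`.)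
[folklore] -/
private theorem tendsto_integral_norm_sq_of_sub {a : α → ℂ} {u : ℕ → α → ℂ} (ha : MemLp a 2 ν)
    (hu : ∀ L, MemLp (u L) 2 ν)
    (hD : Tendsto (fun L => ∫ x, ‖a x - u L x‖ ^ 2 ∂ν) atTop (𝓝 0)) :
    Tendsto (fun L => ∫ x, ‖u L x‖ ^ 2 ∂ν) atTop (𝓝 (∫ x, ‖a x‖ ^ 2 ∂ν)) := by
  set A := ∫ x, ‖a x‖ ^ 2 ∂ν with hA_def
  have hA : 0 ≤ A := integral_nonneg fun x => sq_nonneg _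
  have hIa : Integrable (fun x => ‖a x‖ ^ 2) ν := integrable_norm_sq_of_memLp₂ ha
  rw [Metric.tendsto_atTop]
  intro ε hε
  -- the auxiliary parameter `t`
  set t : ℝ := min (1 / 2) (ε / (8 * (A + 1))) with ht_def
  have ht0 : 0 < t := lt_min (by norm_num) (by positivity)
  have ht_half : t ≤ 1 / 2 := min_le_left _ _
  have htA : t * A ≤ ε / 8 := by
    have h1 : t ≤ ε / (8 * (A + 1)) := min_le_right _ _
    calc t * A ≤ ε / (8 * (A + 1)) * A := mul_le_mul_of_nonneg_right h1 hA
      _ ≤ ε / (8 * (A + 1)) * (A + 1) :=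
          mul_le_mul_of_nonneg_left (by linarith) (by positivity)
      _ = ε / 8 := by field_simp
  set K : ℝ := 1 + t⁻¹ with hK_def
  have hK : 0 < K := by positivity
  obtain ⟨N, hN⟩ := (Metric.tendsto_atTop.1 hD) (ε / 4 / K) (by positivity)
  refine ⟨N, fun L hL => ?_⟩
  set B := ∫ x, ‖u L x‖ ^ 2 ∂ν with hB_def
  set D := ∫ x, ‖a x - u L x‖ ^ 2 ∂ν with hD_def
  have hB : 0 ≤ B := integral_nonneg fun x => sq_nonneg _
  have hD0 : 0 ≤ D := integral_nonneg fun x => sq_nonneg _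
  have hKD : K * D < ε / 4 := by
    have h := hN L hL
    rw [Real.dist_eq, sub_zero, abs_of_nonneg hD0] at h
    rwa [lt_div_iff₀ hK, mul_comm] at h
  have hIu : Integrable (fun x => ‖u L x‖ ^ 2) ν := integrable_norm_sq_of_memLp₂ (hu L)
  have hId : Integrable (fun x => ‖a x - u L x‖ ^ 2) ν :=
    integrable_norm_sq_of_memLp₂ (ha.sub (hu L))
  have hI3 : Integrable (fun x => K * ‖a x - u L x‖ ^ 2) ν := hId.const_mul K
  -- `B ≤ (1 + t) A + K D`
  have h1 : B ≤ A + t * A + K * D := by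
    have hI4 : Integrable (fun x => t * ‖a x‖ ^ 2) ν := hIa.const_mul t
    have hI2 : Integrable (fun x => ‖a x‖ ^ 2 + t * ‖a x‖ ^ 2) ν := hIa.add hI4
    have hI : Integrable (fun x => ‖a x‖ ^ 2 + t * ‖a x‖ ^ 2 + K * ‖a x - u L x‖ ^ 2) ν :=
      hI2.add hI3
    calc B ≤ ∫ x, (‖a x‖ ^ 2 + t * ‖a x‖ ^ 2 + K * ‖a x - u L x‖ ^ 2) ∂ν :=
          integral_mono hIu hI fun x => by
            have h := norm_sq_le_of_pos ht0 (u L x) (a x)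
            rw [norm_sub_rev (u L x) (a x)] at h
            exact h
      _ = A + t * A + K * D := by
          rw [integral_add hI2 hI3, integral_add hIa hI4, integral_const_mul, integral_const_mul]
  -- `A ≤ (1 + t) B + K D`
  have h2 : A ≤ B + t * B + K * D := by
    have hI4 : Integrable (fun x => t * ‖u L x‖ ^ 2) ν := hIu.const_mul t
    have hI2 : Integrable (fun x => ‖u L x‖ ^ 2 + t * ‖u L x‖ ^ 2) ν := hIu.add hI4
    have hI : Integrable (fun x => ‖u L x‖ ^ 2 + t * ‖u L x‖ ^ 2 + K * ‖a x - u L x‖ ^ 2) ν :=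
      hI2.add hI3
    calc A ≤ ∫ x, (‖u L x‖ ^ 2 + t * ‖u L x‖ ^ 2 + K * ‖a x - u L x‖ ^ 2) ∂ν :=
          integral_mono hIa hI fun x => norm_sq_le_of_pos ht0 (a x) (u L x)
      _ = B + t * B + K * D := by
          rw [integral_add hI2 hI3, integral_add hIu hI4, integral_const_mul, integral_const_mul]
  rw [Real.dist_eq, abs_sub_lt_iff]
  constructor
  · linarith
  · have htB : t * B ≤ t * A + t * (t * A) + t * (K * D) := by
      have h := mul_le_mul_of_nonneg_left h1 ht0.le
      linarith
    have e1 : t * (t * A) ≤ 1 / 2 * (ε / 8) :=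
      mul_le_mul ht_half htA (by positivity) (by norm_num)
    have e2 : t * (K * D) ≤ 1 / 2 * (ε / 4) :=
      mul_le_mul ht_half hKD.le (by positivity) (by norm_num)
    linarith

end Squeeze

/-! ### Scrambled points are uniformly distributed: transfer of integrals and of `L_p` -/

section Transfer

variable [NeZero b]

omit [NeZero b] in
/-- `Π ↦ (ξ)_Π` is measurable for a fixed digit sequence `ξ`. [folklore] -/
private theorem measurable_scrambleDigits_fixed (ξ : ℕ → Fin b) :
    Measurable fun π : Scramble b => scrambleDigits b π ξ :=
  measurable_pi_lambda _ fun k =>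
    (measurable_from_top (f := fun p : Equiv.Perm (Fin b) => p (ξ k))).comp
      (measurable_pi_apply (⟨k, digitsPrefix b k ξ⟩ : (k : ℕ) × (Fin k → Fin b)))

/-- A function in `L_p` of the digit space, evaluated at a scrambled point, is in `L_p` of the
scramble space (the scrambled point is uniformly distributed, `map_scrambleDigits_scrambleMeasure`).
[cite: DickPillichshammer2010, Prop. 13.1] -/
private theorem memLp_comp_scrambleDigits {p : ℝ≥0∞} {g : (ℕ → Fin b) → ℂ}
    (hg : MemLp g p (digitSeqMeasure b)) (ξ : ℕ → Fin b) :
    MemLp (fun π : Scramble b => g (scrambleDigits b π ξ)) p (scrambleMeasure b) := by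
  have hg' : MemLp g p ((scrambleMeasure b).map fun π : Scramble b => scrambleDigits b π ξ) := by
    rw [map_scrambleDigits_scrambleMeasure b ξ]
    exact hg
  exact hg'.comp_of_map (measurable_scrambleDigits_fixed ξ).aemeasurable

/-- `∫ g((ξ)_Π) dΠ = ∫ g`: a scrambled point is uniformly distributed.
[cite: DickPillichshammer2010, Prop. 13.1] -/
private theorem integral_comp_scrambleDigits {g : (ℕ → Fin b) → ℂ}
    (hg : AEStronglyMeasurable g (digitSeqMeasure b)) (ξ : ℕ → Fin b) :
    ∫ π, g (scrambleDigits b π ξ) ∂scrambleMeasure b = ∫ η, g η ∂digitSeqMeasure b := by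
  have hφ : AEMeasurable (fun π : Scramble b => scrambleDigits b π ξ) (scrambleMeasure b) :=
    (measurable_scrambleDigits_fixed ξ).aemeasurable
  have hF : AEStronglyMeasurable g
      ((scrambleMeasure b).map fun π : Scramble b => scrambleDigits b π ξ) := by
    rw [map_scrambleDigits_scrambleMeasure b ξ]
    exact hg
  calc ∫ π, g (scrambleDigits b π ξ) ∂scrambleMeasure b
      = ∫ η, g η ∂((scrambleMeasure b).map fun π : Scramble b => scrambleDigits b π ξ) :=
        (integral_map hφ hF).symm
    _ = ∫ η, g η ∂digitSeqMeasure b := by rw [map_scrambleDigits_scrambleMeasure b ξ]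

/-- `∫ |g((ξ)_Π)|² dΠ = ∫ |g|²`. [cite: DickPillichshammer2010, Prop. 13.1] -/
private theorem integral_norm_sq_comp_scrambleDigits {g : (ℕ → Fin b) → ℂ}
    (hg : AEStronglyMeasurable g (digitSeqMeasure b)) (ξ : ℕ → Fin b) :
    ∫ π, ‖g (scrambleDigits b π ξ)‖ ^ 2 ∂scrambleMeasure b =
      ∫ η, ‖g η‖ ^ 2 ∂digitSeqMeasure b := by
  have hφ : AEMeasurable (fun π : Scramble b => scrambleDigits b π ξ) (scrambleMeasure b) :=
    (measurable_scrambleDigits_fixed ξ).aemeasurable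
  have hF : AEStronglyMeasurable (fun η => ‖g η‖ ^ 2)
      ((scrambleMeasure b).map fun π : Scramble b => scrambleDigits b π ξ) := by
    rw [map_scrambleDigits_scrambleMeasure b ξ]
    exact (continuous_pow 2).comp_aestronglyMeasurable hg.norm
  calc ∫ π, ‖g (scrambleDigits b π ξ)‖ ^ 2 ∂scrambleMeasure b
      = ∫ η, ‖g η‖ ^ 2 ∂((scrambleMeasure b).map fun π : Scramble b => scrambleDigits b π ξ) :=
        (integral_map hφ hF).symm
    _ = ∫ η, ‖g η‖ ^ 2 ∂digitSeqMeasure b := by rw [map_scrambleDigits_scrambleMeasure b ξ]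

variable {κ : Type*} [Fintype κ]

/-- **Unbiasedness of the scrambled estimator**, `E[Î(f)] = ∫ f`, for every integrable `f` on the
digit space. [cite: DickPillichshammer2010, Prop. 13.1] (and the display following it in §13.1:
the randomised QMC rule "yields an unbiased estimator"; `integral_scrambledAverage_walshPoly` is the
case of a Walsh polynomial.) -/
theorem integral_scrambledAverage [Nonempty κ] (ξ : κ → ℕ → Fin b) {f : (ℕ → Fin b) → ℂ}
    (hf : Integrable f (digitSeqMeasure b)) :
    ∫ π, scrambledAverage b π ξ f ∂scrambleMeasure b = ∫ η, f η ∂digitSeqMeasure b := by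
  have hI : ∀ n, Integrable (fun π : Scramble b => f (scrambleDigits b π (ξ n)))
      (scrambleMeasure b) := fun n =>
    memLp_one_iff_integrable.1 (memLp_comp_scrambleDigits (memLp_one_iff_integrable.2 hf) (ξ n))
  simp only [scrambledAverage]
  rw [integral_const_mul, integral_finsetSum _ fun n _ => hI n]
  simp_rw [integral_comp_scrambleDigits hf.1]
  rw [sum_const, card_univ, nsmul_eq_mul, ← mul_assoc,
    inv_mul_cancel₀ (Nat.cast_ne_zero.2 Fintype.card_ne_zero), one_mul]

omit [NeZero b] in
/-- `Î` is linear: `Î(f - g) = Î(f) - Î(g)`. [folklore] -/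
private theorem scrambledAverage_sub (π : Scramble b) (ξ : κ → ℕ → Fin b) (f g : (ℕ → Fin b) → ℂ) :
    scrambledAverage b π ξ (f - g) = scrambledAverage b π ξ f - scrambledAverage b π ξ g := by
  simp only [scrambledAverage, Pi.sub_apply, sum_sub_distrib, mul_sub]

/-- `Î(f) ∈ L_p` of the scramble space for `f ∈ L_p` of the digit space. [folklore] -/
private theorem memLp_scrambledAverage (ξ : κ → ℕ → Fin b) {f : (ℕ → Fin b) → ℂ} {p : ℝ≥0∞}
    (hf : MemLp f p (digitSeqMeasure b)) :
    MemLp (fun π : Scramble b => scrambledAverage b π ξ f) p (scrambleMeasure b) := by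
  unfold scrambledAverage
  exact (memLp_finsetSum _ fun n _ => memLp_comp_scrambleDigits hf (ξ n)).const_mul _

omit [NeZero b] in
/-- Jensen: `|Î(g)|² ≤ (1/N) Σ_n |g((ξ_n)_Π)|²`. [folklore] -/
private theorem norm_sq_scrambledAverage_le [Nonempty κ] (π : Scramble b) (ξ : κ → ℕ → Fin b)
    (g : (ℕ → Fin b) → ℂ) :
    ‖scrambledAverage b π ξ g‖ ^ 2 ≤
      (Fintype.card κ : ℝ)⁻¹ * ∑ n, ‖g (scrambleDigits b π (ξ n))‖ ^ 2 := by
  have hN : (Fintype.card κ : ℝ) ≠ 0 := Nat.cast_ne_zero.2 Fintype.card_ne_zero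
  rw [scrambledAverage, norm_mul, norm_inv, Complex.norm_natCast, mul_pow, inv_pow]
  have h1 : ‖∑ n, g (scrambleDigits b π (ξ n))‖ ^ 2 ≤
      (∑ n, ‖g (scrambleDigits b π (ξ n))‖) ^ 2 :=
    pow_le_pow_left₀ (norm_nonneg _) (norm_sum_le _ _) 2
  have h2 : (∑ n, ‖g (scrambleDigits b π (ξ n))‖) ^ 2 ≤
      (Fintype.card κ : ℝ) * ∑ n, ‖g (scrambleDigits b π (ξ n))‖ ^ 2 := by
    have h := sq_sum_le_card_mul_sum_sq (s := (univ : Finset κ))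
      (f := fun n => ‖g (scrambleDigits b π (ξ n))‖)
    rwa [card_univ] at h
  calc ((Fintype.card κ : ℝ) ^ 2)⁻¹ * ‖∑ n, g (scrambleDigits b π (ξ n))‖ ^ 2
      ≤ ((Fintype.card κ : ℝ) ^ 2)⁻¹ *
          ((Fintype.card κ : ℝ) * ∑ n, ‖g (scrambleDigits b π (ξ n))‖ ^ 2) :=
        mul_le_mul_of_nonneg_left (h1.trans h2) (by positivity)
    _ = (Fintype.card κ : ℝ)⁻¹ * ∑ n, ‖g (scrambleDigits b π (ξ n))‖ ^ 2 := by
        rw [pow_two, mul_inv, mul_assoc, inv_mul_cancel_left₀ hN]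

/-- **`E|Î(g)|² ≤ ∫ |g|²`** for `g ∈ L_2` of the digit space — by Jensen's inequality and the
uniform distribution of each scrambled point (Proposition 13.1): the randomised estimator is an
`L_2`-contraction. [folklore] (consequence of [cite: DickPillichshammer2010, Prop. 13.1]) -/
theorem integral_norm_sq_scrambledAverage_le [Nonempty κ] (ξ : κ → ℕ → Fin b)
    {g : (ℕ → Fin b) → ℂ} (hg : MemLp g 2 (digitSeqMeasure b)) :
    ∫ π, ‖scrambledAverage b π ξ g‖ ^ 2 ∂scrambleMeasure b ≤
      ∫ η, ‖g η‖ ^ 2 ∂digitSeqMeasure b := by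
  have hN : (Fintype.card κ : ℝ) ≠ 0 := Nat.cast_ne_zero.2 Fintype.card_ne_zero
  have hI : ∀ n, Integrable (fun π : Scramble b => ‖g (scrambleDigits b π (ξ n))‖ ^ 2)
      (scrambleMeasure b) := fun n =>
    integrable_norm_sq_of_memLp₂ (memLp_comp_scrambleDigits hg (ξ n))
  have hIS : Integrable (fun π : Scramble b => ∑ n, ‖g (scrambleDigits b π (ξ n))‖ ^ 2)
      (scrambleMeasure b) := integrable_finsetSum _ fun n _ => hI n
  have hIs : Integrable (fun π : Scramble b =>
      (Fintype.card κ : ℝ)⁻¹ * ∑ n, ‖g (scrambleDigits b π (ξ n))‖ ^ 2) (scrambleMeasure b) :=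
    hIS.const_mul _
  calc ∫ π, ‖scrambledAverage b π ξ g‖ ^ 2 ∂scrambleMeasure b
      ≤ ∫ π, (Fintype.card κ : ℝ)⁻¹ * ∑ n, ‖g (scrambleDigits b π (ξ n))‖ ^ 2
          ∂scrambleMeasure b :=
        integral_mono (integrable_norm_sq_of_memLp₂ (memLp_scrambledAverage ξ hg)) hIs
          fun π => norm_sq_scrambledAverage_le π ξ g
    _ = (Fintype.card κ : ℝ)⁻¹ * ∑ n : κ, ∫ η, ‖g η‖ ^ 2 ∂digitSeqMeasure b := by
        rw [integral_const_mul, integral_finsetSum _ fun n _ => hI n]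
        simp_rw [integral_norm_sq_comp_scrambleDigits hg.1]
    _ = ∫ η, ‖g η‖ ^ 2 ∂digitSeqMeasure b := by
        rw [sum_const, card_univ, nsmul_eq_mul, ← mul_assoc, inv_mul_cancel₀ hN, one_mul]

end Transfer

/-! ### Corollary 13.4 and Theorem 13.5 for square-integrable integrands -/

section MainL2

variable [NeZero b] {κ : Type*} [Fintype κ]

/-- `E_L f = S_{b^L}(·, f)` is the Walsh polynomial with coefficients `f̂(k)`, `k < b^L`.
[cite: DickPillichshammer2010, Lemma A.17] -/
theorem walshPoly_walshCoeffD_eq_levelMean (hb : 1 < b) {f : (ℕ → Fin b) → ℂ}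
    (hf : Integrable f (digitSeqMeasure b)) (L : ℕ) :
    walshPoly b L (walshCoeffD b f) = levelMean b L f :=
  funext fun η => sum_walshCoeffD_mul_walshD hb hf L η

/-- A Walsh polynomial is in every `L_p`. [folklore] -/
private theorem memLp_walshPoly (L : ℕ) (c : ℕ → ℂ) (p : ℝ≥0∞) :
    MemLp (walshPoly b L c) p (digitSeqMeasure b) := by
  have hmeas : Measurable (walshPoly b L c) :=
    Finset.measurable_sum (range (b ^ L)) fun k _ => (measurable_walshD k).const_mul (c k)
  refine MemLp.of_bound hmeas.aestronglyMeasurable (∑ k ∈ range (b ^ L), ‖c k‖)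
    (ae_of_all _ fun η => ?_)
  calc ‖walshPoly b L c η‖ ≤ ∑ k ∈ range (b ^ L), ‖c k * walshD b k η‖ := norm_sum_le _ _
    _ = ∑ k ∈ range (b ^ L), ‖c k‖ :=
        sum_congr rfl fun k _ => by rw [norm_mul, norm_walshD, mul_one]

/-- `E_L f ∈ L_p` for integrable `f` (it is a Walsh polynomial). [folklore] -/
private theorem memLp_levelMean (hb : 1 < b) {f : (ℕ → Fin b) → ℂ}
    (hf : Integrable f (digitSeqMeasure b)) (L : ℕ) (p : ℝ≥0∞) :
    MemLp (levelMean b L f) p (digitSeqMeasure b) := by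
  rw [← walshPoly_walshCoeffD_eq_levelMean hb hf L]
  exact memLp_walshPoly L _ p

/-- **The centred second moments of `Î(E_L f)` converge to that of `Î(f)`** as `L → ∞`, for
`f ∈ L_2` of the digit space and any centre `z` — since `E|Î(f - E_L f)|² ≤ ∫ |f - E_L f|² → 0`.
[folklore] (from [cite: DickPillichshammer2010, Thm. A.19] (3) and Prop. 13.1) -/
theorem tendsto_integral_norm_sq_scrambledAverage_levelMean (hb : 1 < b) [Nonempty κ]
    (ξ : κ → ℕ → Fin b) {f : (ℕ → Fin b) → ℂ} (hf : MemLp f 2 (digitSeqMeasure b)) (z : ℂ) :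
    Tendsto (fun L => ∫ π, ‖scrambledAverage b π ξ (levelMean b L f) - z‖ ^ 2 ∂scrambleMeasure b)
      atTop (𝓝 (∫ π, ‖scrambledAverage b π ξ f - z‖ ^ 2 ∂scrambleMeasure b)) := by
  have hfI : Integrable f (digitSeqMeasure b) := hf.integrable one_le_two
  have hLmem : ∀ L, MemLp (levelMean b L f) 2 (digitSeqMeasure b) := fun L =>
    memLp_levelMean hb hfI L 2
  have ha : MemLp (fun π : Scramble b => scrambledAverage b π ξ f - z) 2 (scrambleMeasure b) :=
    (memLp_scrambledAverage ξ hf).sub (memLp_const z)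
  have hu : ∀ L, MemLp (fun π : Scramble b => scrambledAverage b π ξ (levelMean b L f) - z) 2
      (scrambleMeasure b) := fun L =>
    (memLp_scrambledAverage ξ (hLmem L)).sub (memLp_const z)
  refine tendsto_integral_norm_sq_of_sub ha hu ?_
  have hle : ∀ L, ∫ π, ‖(scrambledAverage b π ξ f - z) -
      (scrambledAverage b π ξ (levelMean b L f) - z)‖ ^ 2 ∂scrambleMeasure b ≤
      ∫ η, ‖(f - levelMean b L f) η‖ ^ 2 ∂digitSeqMeasure b := fun L => by
    have heq : ∀ π : Scramble b, (scrambledAverage b π ξ f - z) -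
        (scrambledAverage b π ξ (levelMean b L f) - z) =
        scrambledAverage b π ξ (f - levelMean b L f) := fun π => by
      rw [scrambledAverage_sub, sub_sub_sub_cancel_right]
    simp_rw [heq]
    exact integral_norm_sq_scrambledAverage_le ξ (hf.sub (hLmem L))
  exact squeeze_zero (fun L => integral_nonneg fun π => sq_nonneg _) hle
    (tendsto_integral_norm_sq_sub_levelMean hb hf)

omit [NeZero b] in
/-- `σ_ℓ² ≥ 0`. [folklore] -/
private theorem blockVariance_nonneg₂ (c : ℕ → ℂ) (ℓ : ℕ) : 0 ≤ blockVariance b c ℓ :=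
  sum_nonneg fun _ _ => by positivity

/-- **`G_ℓ ≥ 0`**: the coefficients `G_ℓ = (b M_ℓ - M_{ℓ-1})/(b-1)` of Corollary 13.4
(`M_w` = the number of ordered pairs of points sharing `w` leading digits) are non-negative:
for `ℓ ≥ 1`, `N⁻² G_ℓ` is the variance of `Î(wal_k)` for the single Walsh function `k = b^{ℓ-1}`
(Corollary 13.4 with `c = δ_k`), and `G_0 = M_0`. [folklore] (implicit in
[cite: DickPillichshammer2010, Cor. 13.4]) -/
theorem gainFactor_nonneg (hb : 1 < b) [Nonempty κ] (ℓ : ℕ) (ξ : κ → ℕ → Fin b) :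
    0 ≤ gainFactor b ℓ ξ := by
  have hb1 : (0 : ℝ) < (b : ℝ) - 1 := by
    have : (2 : ℝ) ≤ b := by exact_mod_cast hb
    linarith
  rcases Nat.eq_zero_or_pos ℓ with rfl | hℓ
  · -- `G_0 = (b M_0 - M_0)/(b - 1) = M_0 ≥ 0`
    have hM : (0 : ℝ) ≤ prefixPairCount b 0 ξ := Nat.cast_nonneg _
    simp only [gainFactor, Nat.zero_sub]
    exact div_nonneg (by nlinarith) hb1.le
  · -- Corollary 13.4 for `c = δ_{k₀}`, `k₀ = b^{ℓ-1}`, `L = ℓ`: `0 ≤ E|Î - c_0|² = N⁻² G_ℓ`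
    set c : ℕ → ℂ := fun k => if k = b ^ (ℓ - 1) then 1 else 0 with hc
    have hnorm : ∀ k, ‖c k‖ ^ 2 = if k = b ^ (ℓ - 1) then 1 else 0 := fun k => by
      simp only [hc]
      split_ifs <;> simp
    have hmem : ∀ ℓ', b ^ (ℓ - 1) ∈ Ico (b ^ (ℓ' - 1)) (b ^ ℓ') ↔ ℓ' = ℓ := fun ℓ' => by
      rw [mem_Ico, pow_le_pow_iff_right₀ hb, pow_lt_pow_iff_right₀ hb]
      omega
    have hblock : ∀ ℓ', blockVariance b c ℓ' = if ℓ' = ℓ then 1 else 0 := fun ℓ' => by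
      simp only [blockVariance, hnorm, sum_ite_eq', hmem]
    have hsum : ∑ ℓ' ∈ Icc 1 ℓ, gainFactor b ℓ' ξ * blockVariance b c ℓ' = gainFactor b ℓ ξ := by
      simp_rw [hblock, mul_ite, mul_one, mul_zero]
      rw [sum_ite_eq', if_pos (mem_Icc.2 ⟨hℓ, le_rfl⟩)]
    have h := integral_norm_sq_scrambledAverage_sub b hb ξ ℓ c
    rw [hsum] at h
    have hpos : 0 ≤ ((Fintype.card κ : ℝ) ^ 2)⁻¹ * gainFactor b ℓ ξ := by
      rw [← h]
      exact integral_nonneg fun π => sq_nonneg _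
    have hN : (0 : ℝ) < ((Fintype.card κ : ℝ) ^ 2)⁻¹ := by
      have : (0 : ℝ) < Fintype.card κ := Nat.cast_pos.2 Fintype.card_pos
      positivity
    exact (mul_nonneg_iff_of_pos_left hN).1 hpos

/-- **Corollary 13.4 for `f ∈ L_2`**, limit form [cite: DickPillichshammer2010, Cor. 13.4]:
`E|Î(f) - ∫ f|² = lim_{L → ∞} N⁻² Σ_{ℓ=1}^{L} G_ℓ σ_ℓ²(f)` — the partial sums are the variances
of `Î(E_L f)` (`integral_norm_sq_scrambledAverage_sub` for the Walsh polynomial `E_L f`). -/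
theorem tendsto_sum_gainFactor_mul_blockVariance (hb : 1 < b) [Nonempty κ] (ξ : κ → ℕ → Fin b)
    {f : (ℕ → Fin b) → ℂ} (hf : MemLp f 2 (digitSeqMeasure b)) :
    Tendsto (fun L => ((Fintype.card κ : ℝ) ^ 2)⁻¹ *
        ∑ ℓ ∈ Icc 1 L, gainFactor b ℓ ξ * blockVariance b (walshCoeffD b f) ℓ) atTop
      (𝓝 (∫ π, ‖scrambledAverage b π ξ f - ∫ η, f η ∂digitSeqMeasure b‖ ^ 2
        ∂scrambleMeasure b)) := by
  have hfI : Integrable f (digitSeqMeasure b) := hf.integrable one_le_two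
  have h := tendsto_integral_norm_sq_scrambledAverage_levelMean hb ξ hf
    (∫ η, f η ∂digitSeqMeasure b)
  refine h.congr fun L => ?_
  rw [← walshPoly_walshCoeffD_eq_levelMean hb hfI L, ← walshCoeffD_zero_eq_integral f,
    integral_norm_sq_scrambledAverage_sub b hb ξ L (walshCoeffD b f)]

/-- **Corollary 13.4 for `f ∈ L_2`** [cite: DickPillichshammer2010, Cor. 13.4]: let `f ∈ L_2`,
`b ≥ 2`, and let the points `x_0, …, x_{N-1}` (digit sequences `ξ_n`) be randomised by one uniform
nested scramble. Then the randomised QMC estimator `Î(f)` has variance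
`Var[Î(f)] = E|Î(f) - ∫ f|² = N⁻² Σ_{ℓ=1}^{∞} (b M_ℓ - M_{ℓ-1})/(b-1) · σ_ℓ²(f)`,
`M_w` the number of ordered pairs of points sharing their first `w` base-`b` digits and
`σ_ℓ²(f) = Σ_{b^{ℓ-1} ≤ k < b^ℓ} |f̂(k)|²` — the series converging (its terms are `≥ 0`,
`gainFactor_nonneg`; the `ℓ = 0` term vanishes as `σ_0² = 0`). -/
theorem hasSum_gainFactor_mul_blockVariance (hb : 1 < b) [Nonempty κ] (ξ : κ → ℕ → Fin b)
    {f : (ℕ → Fin b) → ℂ} (hf : MemLp f 2 (digitSeqMeasure b)) :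
    HasSum (fun ℓ => ((Fintype.card κ : ℝ) ^ 2)⁻¹ *
        (gainFactor b ℓ ξ * blockVariance b (walshCoeffD b f) ℓ))
      (∫ π, ‖scrambledAverage b π ξ f - ∫ η, f η ∂digitSeqMeasure b‖ ^ 2
        ∂scrambleMeasure b) := by
  have hnn : ∀ ℓ, 0 ≤ ((Fintype.card κ : ℝ) ^ 2)⁻¹ *
      (gainFactor b ℓ ξ * blockVariance b (walshCoeffD b f) ℓ) := fun ℓ =>
    mul_nonneg (by positivity)
      (mul_nonneg (gainFactor_nonneg hb ℓ ξ) (blockVariance_nonneg₂ _ ℓ))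
  rw [hasSum_iff_tendsto_nat_of_nonneg hnn]
  have h0 : blockVariance b (walshCoeffD b f) 0 = 0 := by simp [blockVariance]
  have heq : ∀ L, ∑ ℓ ∈ range (L + 1), ((Fintype.card κ : ℝ) ^ 2)⁻¹ *
      (gainFactor b ℓ ξ * blockVariance b (walshCoeffD b f) ℓ) =
      ((Fintype.card κ : ℝ) ^ 2)⁻¹ *
        ∑ ℓ ∈ Icc 1 L, gainFactor b ℓ ξ * blockVariance b (walshCoeffD b f) ℓ := fun L => by
    rw [← mul_sum, range_eq_Ico, sum_eq_sum_Ico_succ_bot (Nat.succ_pos L), h0, mul_zero,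
      Nat.succ_eq_add_one, Finset.Ico_add_one_right_eq_Icc]
    simp
  have h := tendsto_sum_gainFactor_mul_blockVariance hb ξ hf
  rw [← tendsto_add_atTop_iff_nat 1]
  exact h.congr fun L => (heq L).symm

/-- The tails `Σ_{m < ℓ ≤ L} σ_ℓ²(f)` converge to `∫ |f - E_m f|²` as `L → ∞` (`f ∈ L_2`).
[cite: DickPillichshammer2010, eq. (13.6)] -/
private theorem tendsto_sum_Ioc_blockVariance (hb : 1 < b) {f : (ℕ → Fin b) → ℂ}
    (hf : MemLp f 2 (digitSeqMeasure b)) (m : ℕ) :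
    Tendsto (fun L => ∑ ℓ ∈ Ioc m L, blockVariance b (walshCoeffD b f) ℓ) atTop
      (𝓝 (∫ η, ‖f η - levelMean b m f η‖ ^ 2 ∂digitSeqMeasure b)) := by
  have h := ((hasSum_blockVariance_walshCoeffD_add hb hf m).tendsto_sum_nat).comp
    (tendsto_sub_atTop_nat m)
  refine h.congr fun L => ?_
  simp only [Function.comp_apply]
  rw [← Finset.Ico_add_one_add_one_eq_Ioc, Finset.sum_Ico_eq_sum_range, Nat.add_sub_add_right]
  exact sum_congr rfl fun j _ => congrArg _ (Nat.add_comm j (m + 1))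

/-- A `(t, m, 1)`-net has at least one point (`N = b^m`). [folklore] -/
private theorem IsDigitNet.nonempty₂ {t m : ℕ} {ξ : κ → ℕ → Fin b} (h : IsDigitNet b t m ξ) :
    Nonempty κ :=
  Fintype.card_pos_iff.1 (h.2.1 ▸ Nat.pow_pos (Nat.pos_of_ne_zero (NeZero.ne b)))

/-- **Theorem 13.5 for `f ∈ L_2`, first part** [cite: DickPillichshammer2010, Thm. 13.5]: let
`f ∈ L_2`, `b ≥ 2`, and let the `b^m` points form a `(0, m, 1)`-net in base `b`, randomised by one
uniform nested scramble. Then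
`Var[Î(f)] = E|Î(f) - ∫ f|² = b^{-m} Σ_{ℓ > m} σ_ℓ²(f) = b^{-m} ∫ |f - E_m f|²`,
`E_m f` the mean of `f` over the elementary interval of order `m` containing the argument (the
second equality is the tail of Parseval's identity (13.6), `hasSum_blockVariance_walshCoeffD_add`;
the series form is `IsDigitNet.hasSum_blockVariance_of_memLp`). -/
theorem IsDigitNet.integral_norm_sq_scrambledAverage_sub_eq_of_memLp (hb : 1 < b) {m : ℕ}
    {ξ : κ → ℕ → Fin b} (h : IsDigitNet b 0 m ξ) {f : (ℕ → Fin b) → ℂ}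
    (hf : MemLp f 2 (digitSeqMeasure b)) :
    ∫ π, ‖scrambledAverage b π ξ f - ∫ η, f η ∂digitSeqMeasure b‖ ^ 2 ∂scrambleMeasure b =
      ((b : ℝ) ^ m)⁻¹ * ∫ η, ‖f η - levelMean b m f η‖ ^ 2 ∂digitSeqMeasure b := by
  haveI := h.nonempty₂
  have hfI : Integrable f (digitSeqMeasure b) := hf.integrable one_le_two
  have h1 := tendsto_integral_norm_sq_scrambledAverage_levelMean hb ξ hf
    (∫ η, f η ∂digitSeqMeasure b)
  have h2 : Tendsto (fun L => ((b : ℝ) ^ m)⁻¹ * ∑ ℓ ∈ Ioc m L, blockVariance b (walshCoeffD b f) ℓ)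
      atTop (𝓝 (((b : ℝ) ^ m)⁻¹ * ∫ η, ‖f η - levelMean b m f η‖ ^ 2 ∂digitSeqMeasure b)) :=
    (tendsto_sum_Ioc_blockVariance hb hf m).const_mul _
  refine tendsto_nhds_unique h1 (h2.congr fun L => ?_)
  rw [← h.integral_norm_sq_scrambledAverage_sub_eq hb L (walshCoeffD b f),
    walshPoly_walshCoeffD_eq_levelMean hb hfI L, walshCoeffD_zero_eq_integral]

/-- **Theorem 13.5 for `f ∈ L_2`, first part, series form** [cite: DickPillichshammer2010,
Thm. 13.5]: for a scrambled `(0, m, 1)`-net in base `b` and `f ∈ L_2`,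
`Var[Î(f)] = b^{-m} Σ_{ℓ = m+1}^{∞} σ_ℓ²(f)` (the series indexed by `j = ℓ - (m+1)`). -/
theorem IsDigitNet.hasSum_blockVariance_of_memLp (hb : 1 < b) {m : ℕ} {ξ : κ → ℕ → Fin b}
    (h : IsDigitNet b 0 m ξ) {f : (ℕ → Fin b) → ℂ} (hf : MemLp f 2 (digitSeqMeasure b)) :
    HasSum (fun j => ((b : ℝ) ^ m)⁻¹ * blockVariance b (walshCoeffD b f) (j + (m + 1)))
      (∫ π, ‖scrambledAverage b π ξ f - ∫ η, f η ∂digitSeqMeasure b‖ ^ 2 ∂scrambleMeasure b) := by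
  rw [h.integral_norm_sq_scrambledAverage_sub_eq_of_memLp hb hf]
  exact (hasSum_blockVariance_walshCoeffD_add hb hf m).mul_left _

/-- **Theorem 13.5 for `f ∈ L_2`, second part** [cite: DickPillichshammer2010, Thm. 13.5]: let
`f ∈ L_2`, `b ≥ 2`, and let the `b^m` points form a `(t, m, 1)`-net in base `b`, randomised by one
uniform nested scramble. Then
`Var[Î(f)] = E|Î(f) - ∫ f|² ≤ b^{t-m} Σ_{ℓ > m-t} σ_ℓ²(f) = b^{t-m} ∫ |f - E_{m-t} f|²`. -/
theorem IsDigitNet.integral_norm_sq_scrambledAverage_sub_le_of_memLp (hb : 1 < b) {t m : ℕ}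
    {ξ : κ → ℕ → Fin b} (h : IsDigitNet b t m ξ) {f : (ℕ → Fin b) → ℂ}
    (hf : MemLp f 2 (digitSeqMeasure b)) :
    ∫ π, ‖scrambledAverage b π ξ f - ∫ η, f η ∂digitSeqMeasure b‖ ^ 2 ∂scrambleMeasure b ≤
      (b : ℝ) ^ t / (b : ℝ) ^ m *
        ∫ η, ‖f η - levelMean b (m - t) f η‖ ^ 2 ∂digitSeqMeasure b := by
  haveI := h.nonempty₂
  have hfI : Integrable f (digitSeqMeasure b) := hf.integrable one_le_two
  have h1 := tendsto_integral_norm_sq_scrambledAverage_levelMean hb ξ hf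
    (∫ η, f η ∂digitSeqMeasure b)
  have h2 : Tendsto (fun L => (b : ℝ) ^ t / (b : ℝ) ^ m *
        ∑ ℓ ∈ Ioc (m - t) L, blockVariance b (walshCoeffD b f) ℓ) atTop
      (𝓝 ((b : ℝ) ^ t / (b : ℝ) ^ m *
        ∫ η, ‖f η - levelMean b (m - t) f η‖ ^ 2 ∂digitSeqMeasure b)) :=
    (tendsto_sum_Ioc_blockVariance hb hf (m - t)).const_mul _
  refine le_of_tendsto_of_tendsto' h1 h2 fun L => ?_
  have h3 := h.integral_norm_sq_scrambledAverage_sub_le hb L (walshCoeffD b f)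
  rwa [walshPoly_walshCoeffD_eq_levelMean hb hfI L, walshCoeffD_zero_eq_integral] at h3

/-- **Theorem 13.5, series form of the `(t, m, 1)` bound** [cite: DickPillichshammer2010,
Thm. 13.5]: `Var[Î(f)] ≤ b^{t-m} Σ_{ℓ = m-t+1}^{∞} σ_ℓ²(f)` for `f ∈ L_2`. -/
theorem IsDigitNet.integral_norm_sq_scrambledAverage_sub_le_tsum_of_memLp (hb : 1 < b) {t m : ℕ}
    {ξ : κ → ℕ → Fin b} (h : IsDigitNet b t m ξ) {f : (ℕ → Fin b) → ℂ}
    (hf : MemLp f 2 (digitSeqMeasure b)) :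
    ∫ π, ‖scrambledAverage b π ξ f - ∫ η, f η ∂digitSeqMeasure b‖ ^ 2 ∂scrambleMeasure b ≤
      (b : ℝ) ^ t / (b : ℝ) ^ m *
        ∑' j, blockVariance b (walshCoeffD b f) (j + (m - t + 1)) := by
  rw [(hasSum_blockVariance_walshCoeffD_add hb hf (m - t)).tsum_eq]
  exact h.integral_norm_sq_scrambledAverage_sub_le_of_memLp hb hf

end MainL2

/-! ### Theorem 13.22 without the finite-precision hypothesis -/

section Holder

variable [NeZero b] {κ : Type*} [Fintype κ]

/-- A digit-Hölder function is bounded (`w = 0`: any two points share `0` digits), hence in every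
`L_p` once measurable. [folklore] -/
private theorem DigitHolderWith.memLp {C q : ℝ} {f : (ℕ → Fin b) → ℂ} (hF : DigitHolderWith b C q f)
    (hfm : AEStronglyMeasurable f (digitSeqMeasure b)) (p : ℝ≥0∞) :
    MemLp f p (digitSeqMeasure b) := by
  set ζ₀ : ℕ → Fin b := fun _ => 0 with hζ₀
  refine MemLp.of_bound hfm (‖f ζ₀‖ + C) (ae_of_all _ fun ζ => ?_)
  have h0 : ‖f ζ - f ζ₀‖ ≤ C * q ^ 0 := hF 0 ζ ζ₀ (funext fun i => i.elim0)
  rw [pow_zero, mul_one] at h0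
  calc ‖f ζ‖ ≤ ‖f ζ₀‖ + ‖f ζ - f ζ₀‖ := norm_le_norm_add_norm_sub' _ _
    _ ≤ ‖f ζ₀‖ + C := by linarith

/-- **Theorem 13.22** [cite: DickPillichshammer2010, Thm. 13.22], for every measurable
digit-Hölder integrand: let `f` on the digit space be (a.e. strongly) measurable and satisfy a
Hölder condition of order `0 < α ≤ 1` with constant `C_f` — `|f(ζ) - f(ζ')| ≤ C_f b^{-αw}`
whenever `ζ, ζ'` share `w` leading digits (for `F` `α`-Hölder on `[0,1]` composed with the digit
expansion this is `DigitHolderWith.comp_ofDigits`). Then the randomised QMC estimator `Î(f)` based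
on a scrambled `(t, m, 1)`-net in base `b` satisfies
`Var[Î(f)] = E|Î(f) - ∫ f|² ≤ b^{-(1+2α)(m-t)} C_f² (b-1)^{1+2α}/(b^{2α} - 1)`
(`√Var = O(N^{-(1+2α)/2})`, `N = b^m`; `O(N^{-3/2})` for Lipschitz `f`). From Theorem 13.5 for
`f ∈ L_2` and Corollary 13.21 (`DigitHolderWith.blockVariance_le_rpow`);
`IsDigitNet.integral_norm_sq_scrambledAverage_sub_le_of_holder` is the finite-precision case. -/
theorem IsDigitNet.integral_norm_sq_scrambledAverage_sub_le_of_holder' (hb : 1 < b) {t m : ℕ}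
    {ξ : κ → ℕ → Fin b} (h : IsDigitNet b t m ξ) {f : (ℕ → Fin b) → ℂ}
    (hfm : AEStronglyMeasurable f (digitSeqMeasure b)) {C α : ℝ} (hα₀ : 0 < α) (hα₁ : α ≤ 1)
    (hF : DigitHolderWith b C ((b : ℝ) ^ (-α)) f) :
    ∫ π, ‖scrambledAverage b π ξ f - ∫ η, f η ∂digitSeqMeasure b‖ ^ 2 ∂scrambleMeasure b ≤
      (b : ℝ) ^ (-((1 + 2 * α) * (m - t : ℕ))) *
        (C ^ 2 * ((b : ℝ) - 1) ^ (1 + 2 * α) / ((b : ℝ) ^ (2 * α) - 1)) := by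
  have hf : MemLp f 2 (digitSeqMeasure b) := hF.memLp hfm 2
  have hfI : Integrable f (digitSeqMeasure b) := hf.integrable one_le_two
  refine (h.integral_norm_sq_scrambledAverage_sub_le_of_memLp hb hf).trans ?_
  set B : ℝ := (b : ℝ) with hBdef
  have hB1 : (1 : ℝ) < B := by rw [hBdef]; exact_mod_cast hb
  have hB0 : 0 < B := by linarith
  have htm : t ≤ m := h.1
  set n := m - t with hn
  set K : ℝ := C ^ 2 * (B - 1) ^ (1 + 2 * α) with hK
  set P : ℝ := B ^ (2 * α) with hP
  have hP1 : 1 < P := Real.one_lt_rpow hB1 (by linarith)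
  have hP0 : 0 < P := by linarith
  set r : ℝ := P⁻¹ with hr
  have hr0 : 0 ≤ r := by positivity
  have hr1 : r < 1 := inv_lt_one_of_one_lt₀ hP1
  have hrpow : ∀ ℓ : ℕ, B ^ (-(2 * α * ℓ)) = r ^ ℓ := by
    intro ℓ
    rw [hr, hP, inv_pow, ← Real.rpow_natCast, ← Real.rpow_mul hB0.le, ← Real.rpow_neg hB0.le]
  -- Corollary 13.21 summed over `ℓ > n`: `∫ |f - E_n f|² = Σ_{ℓ > n} σ_ℓ² ≤ K r^{n+1}/(1-r)`
  have hterm : ∀ j : ℕ,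
      blockVariance b (walshCoeffD b f) (j + (n + 1)) ≤ K * r ^ (n + 1) * r ^ j := by
    intro j
    have h1 : blockVariance b (walshCoeffD b f) (j + (n + 1)) ≤ K * r ^ (j + (n + 1)) := by
      rw [← hrpow]
      exact hF.blockVariance_le_rpow hb hα₁ hfI (by omega)
    calc blockVariance b (walshCoeffD b f) (j + (n + 1)) ≤ K * r ^ (j + (n + 1)) := h1
      _ = K * r ^ (n + 1) * r ^ j := by rw [pow_add]; ring
  have htail : ∫ η, ‖f η - levelMean b n f η‖ ^ 2 ∂digitSeqMeasure b ≤
      K * (r ^ (n + 1) / (1 - r)) := by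
    have hS := hasSum_blockVariance_walshCoeffD_add hb hf n
    have hG : HasSum (fun j : ℕ => K * r ^ (n + 1) * r ^ j) (K * r ^ (n + 1) * (1 - r)⁻¹) :=
      (hasSum_geometric_of_lt_one hr0 hr1).mul_left _
    have hle := hasSum_le hterm hS hG
    rw [div_eq_mul_inv, ← mul_assoc]
    exact hle
  -- the prefactor `b^t/b^m = b^{-(m-t)}` and the final algebra
  have hpre : B ^ t / B ^ m = (B ^ n)⁻¹ := by
    rw [show m = n + t by omega, pow_add]
    field_simp
  have hfin : (B ^ n)⁻¹ * (K * (r ^ (n + 1) / (1 - r))) =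
      B ^ (-((1 + 2 * α) * n)) * (K / (P - 1)) := by
    have hBn : B ^ (-((1 + 2 * α) * n)) = (B ^ n)⁻¹ * r ^ n := by
      rw [Real.rpow_neg hB0.le, Real.rpow_mul hB0.le, Real.rpow_natCast, Real.rpow_add hB0,
        Real.rpow_one, mul_pow, mul_inv, hr, inv_pow]
    have hP1' : P - 1 ≠ 0 := by linarith
    rw [hBn, pow_succ, hr]
    field_simp
  calc B ^ t / B ^ m * ∫ η, ‖f η - levelMean b n f η‖ ^ 2 ∂digitSeqMeasure b
      ≤ B ^ t / B ^ m * (K * (r ^ (n + 1) / (1 - r))) :=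
        mul_le_mul_of_nonneg_left htail (by positivity)
    _ = B ^ (-((1 + 2 * α) * n)) * (K / (P - 1)) := by rw [hpre, hfin]

end Holder

end Literature.Analysis.Quadrature
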